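import Mathlib
import Summits.ResolutionOfSingularities.ResolutionOfSingularities.Theses.SyzygyFlattening
import Summits.ResolutionOfSingularities.ResolutionOfSingularities.Theorems.SyzygyFlatteningDefs
import Summits.ResolutionOfSingularities.ResolutionOfSingularities.Theorems.SyzygyFlatteningHigherRankTerminationTowerStageBasic
import Summits.ResolutionOfSingularities.ResolutionOfSingularities.Theorems.SyzygyFlatteningHigherRankTerminationLocAt
import Summits.ResolutionOfSingularities.ResolutionOfSingularities.Theorems.SyzygyFlatteningHigherRankTerminationNrmLocAt
import Summits.ResolutionOfSingularities.ResolutionOfSingularities.Theorems.SyzygyFlatteningHigherRankTerminationEssFiniteType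
import Summits.ResolutionOfSingularities.ResolutionOfSingularities.Theorems.SyzygyFlatteningHigherRankTerminationRegularStep
import Summits.ResolutionOfSingularities.ResolutionOfSingularities.Theorems.SyzygyFlatteningHigherRankTerminationTowerLocalisation
import Summits.ResolutionOfSingularities.ResolutionOfSingularities.Theorems.SyzygyFlatteningRankOneTerminationStageNormal
import Summits.ResolutionOfSingularities.ResolutionOfSingularities.Theorems.SyzygyFlatteningRankOneTerminationStageDim
import Summits.ResolutionOfSingularities.ResolutionOfSingularities.Theorems.SyzygyFlatteningRankOneTerminationReduction
import Summits.ResolutionOfSingularities.ResolutionOfSingularities.Theorems.SyzygyFlatteningRankOneTerminationMinGenerators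
import Summits.ResolutionOfSingularities.ResolutionOfSingularities.Theorems.SyzygyFlatteningRankOneTerminationDetLemmas
import Summits.ResolutionOfSingularities.ResolutionOfSingularities.Theorems.SyzygyFlatteningRankOneTerminationExtendResolution
import Literature.AlgebraicGeometry.Resolution.NormalSurfaceSingularLocus
import Literature.AlgebraicGeometry.Resolution.RankOneReductionProofs
import Literature.AlgebraicGeometry.Resolution.IntegralClosureEssFiniteType
import HarnessLib

/-!
# The surface step, I: the datum at a singular surface stage
# (crux stmt-ResolutionOfSingularities-17044, line `birth`)

Crux `RankOneTermination` (route `SyzygyFlattening`): valuative termination of the tower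
`T₀ = locAt O A`, `T_{m+1} = locAt O (nrm (chart O T_m))`.  This file proves the registered stub
`stub_surfaceStep`: for `tr.deg_k K = 2`, at a SINGULAR stage `T_{m+1}` the next stage is
Zariski's normalised quadratic transform along the valuation,
`T_{m+2} = locAt O (nrm (T_{m+1}[𝔪/x]))`, `x ∈ 𝔪` of maximal valuation.  This is the `n = 2`
case of the lead's theorem "at an isolated singular stage the norm blow-up of `Ωⁿ(κ)` is the
blow-up of the closed point, up to normalisation" (Cruxes/RankOneTermination/NOTES.md), and it
turns the `n = 2` case of the crux into Lipman's theorem (the tower from `T₁` on IS the sequence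
"blow up the singular point, normalise" followed along `v`).

Ingredients (all landed): `stub_minGenerators` (minimal generators `xg` of `𝔪`, `xg 0` of maximal
valuation, relations with coefficients in `𝔪`), `stub_extendResolution` (a free resolution of
`B ⧸ J` extending the minimal presentation, second syzygies `≅ Syz(xg)`), `stub_detLemmas`
(determinant identities), the canonical form `locAt_step_eq` of one step (datum independence),
`stub_surfaceIsolated`, `stub_stageNormal`, `stub_stageDim`.

* `surfaceStep_datum` — the datum: `ι` = delete the `xg 0`-coordinate (injective, torsion
  cokernel), Koszul frame `g₀` with `det = (xg 0)^{e+2}`, `O`-minimal, all ratios in `B[𝔪/xg 0]`,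
  arrow tuples realising `(xg (i+1) / xg 0)^{e+1}`;
* `stub_surfaceDatum` — the same in registered `∀`-form (glue stub of the line).
The assembly (`step_eq_quadraticTransform`, `stub_surfaceStep`) is in
`SyzygyFlatteningRankOneTerminationSurfaceStep.lean`.
-/

noncomputable section

-- single-problem summit: the doubled namespace component `ResolutionOfSingularities` is forced
set_option linter.dupNamespace false

namespace Summit.ResolutionOfSingularities.ResolutionOfSingularities.Theorems.SyzygyFlattening

open IsLocalRing
open Literature.AlgebraicGeometry.Resolution (ne_zero_of_valuation_eq_one isFractionRing_subalgebra_of_le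
  isIntegral_of_mem_subalgebra)

variable {k K : Type} [Field k] [Field K] [Algebra k K]

/-! ## Units and the maximal ideal of a stage closed under `locAt O` -/

/-- In a stage `B ⊆ O` closed under `locAt O`, an element is in the maximal ideal iff its
valuation is `< 1` (the units of `B` are exactly the `O`-units of `B`). [folklore] -/
theorem mem_maximalIdeal_iff_valuation_lt_one (O : ValuationSubring K) (B : Subalgebra k K)
    [IsLocalRing ↥B] (hB : B.toSubring ≤ O.toSubring) (hloc : locAt O B = B) (b : ↥B) :
    b ∈ maximalIdeal ↥B ↔ O.valuation (b : K) < 1 := by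
  have hbO : (b : K) ∈ O := hB (Subalgebra.mem_toSubring.mpr b.2)
  have hle : O.valuation (b : K) ≤ 1 := (O.valuation_le_one_iff _).mpr hbO
  rw [IsLocalRing.mem_maximalIdeal, mem_nonunits_iff]
  constructor
  · intro hnu
    refine lt_of_le_of_ne hle fun hv => hnu ?_
    have hb0 : (b : K) ≠ 0 := ne_zero_of_valuation_eq_one hv
    have hinv : (b : K)⁻¹ ∈ B := by
      have := inv_mem_locAt O B hB (self_le_locAt O B b.2) hv
      rwa [hloc] at this
    refine isUnit_iff_exists_inv.mpr ⟨⟨(b : K)⁻¹, hinv⟩, Subtype.ext ?_⟩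
    change (b : K) * (b : K)⁻¹ = 1
    exact mul_inv_cancel₀ hb0
  · intro hv hu
    obtain ⟨c, hc⟩ := hu.exists_right_inv
    have hcO : ((c : ↥B) : K) ∈ O := hB (Subalgebra.mem_toSubring.mpr c.2)
    have hcle : O.valuation ((c : ↥B) : K) ≤ 1 := (O.valuation_le_one_iff _).mpr hcO
    have h1 : O.valuation ((b : K) * (c : K)) = 1 := by
      have := congrArg (fun z : ↥B => O.valuation (z : K)) hc
      simpa using this
    rw [Valuation.map_mul] at h1
    have : O.valuation (b : K) * O.valuation ((c : ↥B) : K) < 1 * 1 :=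
      mul_lt_mul_of_lt_of_le_of_nonneg_of_pos hv hcle zero_le zero_lt_one
    rw [one_mul, h1] at this
    exact lt_irrefl _ this


/-! ## The datum at a singular surface stage: Koszul frame, arrow tuples, ratios -/

/-- Valuation bound: in a stage closed under `locAt O`, every element of the maximal ideal has
valuation at most that of a generator of maximal valuation. [folklore] -/
theorem valuation_le_of_mem_maximalIdeal (O : ValuationSubring K) (B : Subalgebra k K)
    [IsLocalRing ↥B] (hB : B.toSubring ≤ O.toSubring) {n : ℕ} (xg : Fin (n + 1) → ↥B)
    (hspan : Ideal.span (Set.range xg) = maximalIdeal ↥B)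
    (hval : ∀ i, O.valuation ((xg i : ↥B) : K) ≤ O.valuation ((xg 0 : ↥B) : K))
    (b : ↥B) (hb : b ∈ maximalIdeal ↥B) :
    O.valuation (b : K) ≤ O.valuation ((xg 0 : ↥B) : K) := by
  rw [← hspan, Ideal.mem_span_range_iff_exists_fun] at hb
  obtain ⟨c, hc⟩ := hb
  have hcK : (b : K) = ∑ i, ((c i : ↥B) : K) * ((xg i : ↥B) : K) := by
    have := congrArg B.val hc.symm
    simpa only [map_sum, map_mul, Subalgebra.coe_val] using this
  rw [hcK]
  refine (O.valuation).map_sum_le fun i _ => ?_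
  rw [Valuation.map_mul]
  have hci : O.valuation ((c i : ↥B) : K) ≤ 1 :=
    (O.valuation_le_one_iff _).mpr (hB (Subalgebra.mem_toSubring.mpr (c i).2))
  calc O.valuation ((c i : ↥B) : K) * O.valuation ((xg i : ↥B) : K)
      ≤ 1 * O.valuation ((xg 0 : ↥B) : K) := mul_le_mul' hci (hval i)
    _ = _ := one_mul _

/-- **The datum.** For a stage `B` closed under `locAt O` with minimal generators
`xg : Fin (e+3) → B` of `𝔪` (`xg 0` of maximal valuation, all relations with coefficients in
`𝔪`), and any free resolution whose second syzygy module `range (d 1)` is identified with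
`Syz(xg) = ker φ` (`φ v = ∑ vᵢ xgᵢ`): the embedding `ι` = "delete the `xg 0`-coordinate" is
injective with torsion cokernel, the Koszul frame `g₀` (`xg 0 · e_{i+1} - xg (i+1) · e_0`) has
`det = (xg 0)^{e+2} ≠ 0` and is `O`-minimal, every ratio `det (ι g') / det (ι g₀)` lies in
`B[𝔪 / xg 0]`, and the arrow tuples realise the ratios `(xg (i+1) / xg 0)^{e+1}`. [folklore] -/
theorem surfaceStep_datum (O : ValuationSubring K) (B : Subalgebra k K) [IsLocalRing ↥B]
    (hB : B.toSubring ≤ O.toSubring) (hloc : locAt O B = B) {e : ℕ} (xg : Fin (e + 3) → ↥B)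
    (hspan : Ideal.span (Set.range xg) = maximalIdeal ↥B)
    (hminrel : ∀ s : Fin (e + 3) → ↥B, ∑ i, s i * xg i = 0 → ∀ i, s i ∈ maximalIdeal ↥B)
    (hval : ∀ i, O.valuation ((xg i : ↥B) : K) ≤ O.valuation ((xg 0 : ↥B) : K))
    (b : ℕ → ℕ) (d : (i : ℕ) → ((Fin (b (i + 1)) → ↥B) →ₗ[↥B] (Fin (b i) → ↥B)))
    (θ : ↥(LinearMap.ker (LinearMap.pi fun _ : Fin 1 => Fintype.linearCombination ↥B xg)) ≃ₗ[↥B]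
      ↥(LinearMap.range (d 1))) :
    ∃ (r : ℕ) (ι : ↥(LinearMap.range (d 1)) →ₗ[↥B] (Fin r → ↥B))
      (g₀ : Fin r → ↥(LinearMap.range (d 1))),
      Function.Injective ι ∧
      (∀ z : Fin r → ↥B, ∃ a : ↥B, a ≠ 0 ∧ a • z ∈ LinearMap.range ι) ∧
      Matrix.det (Matrix.of fun i j => ((ι (g₀ i) j : ↥B) : K)) ≠ 0 ∧
      (∀ g' : Fin r → ↥(LinearMap.range (d 1)),
        Matrix.det (Matrix.of fun i j => ((ι (g' i) j : ↥B) : K)) *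
          (Matrix.det (Matrix.of fun i j => ((ι (g₀ i) j : ↥B) : K)))⁻¹ ∈ O) ∧
      (∀ g' : Fin r → ↥(LinearMap.range (d 1)),
        Matrix.det (Matrix.of fun i j => ((ι (g' i) j : ↥B) : K)) *
          (Matrix.det (Matrix.of fun i j => ((ι (g₀ i) j : ↥B) : K)))⁻¹ ∈
          Algebra.adjoin k ((B : Set K) ∪
            {y : K | ∃ a ∈ B, O.valuation a < 1 ∧ y = a * (((xg 0 : ↥B) : K))⁻¹})) ∧
      (∀ i : Fin (e + 2), ∃ g' : Fin r → ↥(LinearMap.range (d 1)),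
        Matrix.det (Matrix.of fun i j => ((ι (g' i) j : ↥B) : K)) *
          (Matrix.det (Matrix.of fun i j => ((ι (g₀ i) j : ↥B) : K)))⁻¹ =
            (((xg i.succ : ↥B) : K) * (((xg 0 : ↥B) : K))⁻¹) ^ (e + 1)) := by
  classical
  -- notation
  set φ : (Fin (e + 3) → ↥B) →ₗ[↥B] (Fin 1 → ↥B) :=
    LinearMap.pi fun _ : Fin 1 => Fintype.linearCombination ↥B xg with hφ
  have hφ_apply : ∀ (v : Fin (e + 3) → ↥B) (j : Fin 1), φ v j = ∑ i, v i * xg i := by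
    intro v j
    simp [hφ, Fintype.linearCombination_apply, smul_eq_mul]
  have hmemker : ∀ v : Fin (e + 3) → ↥B, v ∈ LinearMap.ker φ ↔ ∑ i, v i * xg i = 0 := by
    intro v
    rw [LinearMap.mem_ker]
    constructor
    · intro h
      have := congrFun h 0
      rwa [hφ_apply] at this
    · intro h
      funext j
      rw [hφ_apply]
      exact h
  -- basic facts on `xg 0`
  have hx0mem : xg 0 ∈ maximalIdeal ↥B := hspan ▸ Ideal.subset_span ⟨0, rfl⟩
  have hx0ne : xg 0 ≠ 0 := by
    intro h0
    have hrel : ∑ i, (if i = 0 then (1 : ↥B) else 0) * xg i = 0 := by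
      simp [h0]
    have := hminrel _ hrel 0
    simp only [if_true] at this
    exact (maximalIdeal.isMaximal ↥B).ne_top ((Ideal.eq_top_iff_one _).mpr this)
  have hx0K : ((xg 0 : ↥B) : K) ≠ 0 := fun h => hx0ne (by exact_mod_cast h)
  have hv0 : O.valuation ((xg 0 : ↥B) : K) ≠ 0 := (Valuation.ne_zero_iff _).mpr hx0K
  obtain ⟨hA, hBdet, hCdet⟩ := stub_detLemmas K
  -- the embedding: delete the `xg 0`-coordinate
  let ι₀ : (Fin (e + 3) → ↥B) →ₗ[↥B] (Fin (e + 2) → ↥B) := LinearMap.funLeft ↥B ↥B Fin.succ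
  let ι : ↥(LinearMap.range (d 1)) →ₗ[↥B] (Fin (e + 2) → ↥B) :=
    ι₀ ∘ₗ (LinearMap.ker φ).subtype ∘ₗ θ.symm.toLinearMap
  have hι_def : ∀ (m : ↥(LinearMap.range (d 1))) (j : Fin (e + 2)),
      ι m j = ((θ.symm m : ↥(LinearMap.ker φ)) : Fin (e + 3) → ↥B) j.succ := fun _ _ => rfl
  have hι_apply : ∀ (v : Fin (e + 3) → ↥B) (hv : v ∈ LinearMap.ker φ) (j : Fin (e + 2)),
      ι (θ ⟨v, hv⟩) j = v j.succ := by
    intro v hv j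
    rw [hι_def, LinearEquiv.symm_apply_apply]
  -- entries of `ι` lie in `𝔪` (relations among minimal generators have coefficients in `𝔪`)
  have hentry : ∀ (m : ↥(LinearMap.range (d 1))) (j : Fin (e + 2)),
      ι m j ∈ maximalIdeal ↥B := by
    intro m j
    have hmem : ((θ.symm m : ↥(LinearMap.ker φ)) : Fin (e + 3) → ↥B) ∈ LinearMap.ker φ :=
      (θ.symm m).2
    rw [hmemker] at hmem
    rw [hι_def]
    exact hminrel _ hmem j.succ
  have hentry_val : ∀ (m : ↥(LinearMap.range (d 1))) (j : Fin (e + 2)),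
      O.valuation ((ι m j : ↥B) : K) * (O.valuation ((xg 0 : ↥B) : K))⁻¹ ≤ 1 := by
    intro m j
    have h := valuation_le_of_mem_maximalIdeal O B hB xg hspan hval _ (hentry m j)
    calc O.valuation ((ι m j : ↥B) : K) * (O.valuation ((xg 0 : ↥B) : K))⁻¹
        ≤ O.valuation ((xg 0 : ↥B) : K) * (O.valuation ((xg 0 : ↥B) : K))⁻¹ :=
          mul_le_mul' h le_rfl
      _ = 1 := mul_inv_cancel₀ hv0
  -- the Koszul frame `xg 0 · e_{i+1} - xg (i+1) · e_0`
  let kv : Fin (e + 2) → (Fin (e + 3) → ↥B) := fun i j =>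
    if j = 0 then -(xg i.succ) else if j = i.succ then xg 0 else 0
  have hkv_succ : ∀ i j : Fin (e + 2), kv i j.succ = if j = i then xg 0 else 0 := by
    intro i j
    simp only [kv, Fin.succ_ne_zero, if_false, Fin.succ_inj]
  have hkv : ∀ i, kv i ∈ LinearMap.ker φ := by
    intro i
    rw [hmemker, Fin.sum_univ_succ]
    simp only [hkv_succ, ite_mul, zero_mul, Finset.sum_ite_eq', Finset.mem_univ, if_true]
    simp only [kv, if_true]
    ring
  let g₀ : Fin (e + 2) → ↥(LinearMap.range (d 1)) := fun i => θ ⟨kv i, hkv i⟩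
  have hg₀ : ∀ i j : Fin (e + 2), ι (g₀ i) j = if j = i then xg 0 else 0 := by
    intro i j
    rw [hι_apply, hkv_succ]
  have hM₀ : (Matrix.of fun i j => ((ι (g₀ i) j : ↥B) : K)) =
      Matrix.of fun i j : Fin (e + 2) => if j = i then ((xg 0 : ↥B) : K) else 0 := by
    ext i j
    simp only [Matrix.of_apply, hg₀]
    split_ifs <;> simp
  have hdet₀ : Matrix.det (Matrix.of fun i j => ((ι (g₀ i) j : ↥B) : K)) =
      ((xg 0 : ↥B) : K) ^ (e + 2) := by
    rw [hM₀, hBdet]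
  refine ⟨e + 2, ι, g₀, ?_, ?_, ?_, ?_, ?_, ?_⟩
  · -- injectivity
    refine (injective_iff_map_eq_zero ι).mpr fun m hm => ?_
    set w : ↥(LinearMap.ker φ) := θ.symm m with hw
    have hw0 : ∀ j : Fin (e + 2), (w : Fin (e + 3) → ↥B) j.succ = 0 := by
      intro j
      have := congrFun hm j
      rwa [hι_def] at this
    have hrel : ∑ i, (w : Fin (e + 3) → ↥B) i * xg i = 0 := (hmemker _).mp w.2
    rw [Fin.sum_univ_succ] at hrel
    simp only [hw0, zero_mul, Finset.sum_const_zero, add_zero] at hrel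
    have hw00 : (w : Fin (e + 3) → ↥B) 0 = 0 :=
      (mul_eq_zero.mp hrel).resolve_right hx0ne
    have hwz : (w : Fin (e + 3) → ↥B) = 0 := by
      funext j
      refine Fin.cases ?_ (fun j => ?_) j
      · exact hw00
      · exact hw0 j
    have hw' : w = 0 := Subtype.ext hwz
    calc m = θ w := by rw [hw, LinearEquiv.apply_symm_apply]
      _ = 0 := by rw [hw', LinearEquiv.map_zero]
  · -- torsion cokernel: `xg 0 • z` is in the range
    intro z
    let wz : Fin (e + 3) → ↥B := Fin.cons (-(∑ b, z b * xg b.succ)) (fun b => xg 0 * z b)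
    have hwz : wz ∈ LinearMap.ker φ := by
      rw [hmemker, Fin.sum_univ_succ]
      simp only [wz, Fin.cons_zero, Fin.cons_succ]
      have : ∑ b, xg 0 * z b * xg b.succ = (∑ b, z b * xg b.succ) * xg 0 := by
        rw [Finset.sum_mul]
        exact Finset.sum_congr rfl fun b _ => by ring
      rw [this]
      ring
    refine ⟨xg 0, hx0ne, θ ⟨wz, hwz⟩, ?_⟩
    funext b
    rw [hι_apply]
    simp only [wz, Fin.cons_succ, Pi.smul_apply, smul_eq_mul]
  · -- the frame determinant is nonzero
    rw [hdet₀]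
    exact pow_ne_zero _ hx0K
  · -- minimality: every ratio lies in `O`
    intro g'
    rw [hdet₀]
    refine hA (e + 2) O.toSubring _ _ hx0K fun i j => ?_
    change _ ∈ O
    rw [← O.valuation_le_one_iff, Valuation.map_mul, map_inv₀, Matrix.of_apply]
    exact hentry_val _ _
  · -- every ratio lies in `B[𝔪 / xg 0]`
    intro g'
    rw [hdet₀]
    refine hA (e + 2) (Algebra.adjoin k ((B : Set K) ∪
      {y : K | ∃ a ∈ B, O.valuation a < 1 ∧ y = a * (((xg 0 : ↥B) : K))⁻¹})).toSubring _ _ hx0K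
      fun i j => ?_
    rw [Subalgebra.mem_toSubring, Matrix.of_apply]
    refine Algebra.subset_adjoin (Or.inr ⟨((ι (g' i) j : ↥B) : K), (ι (g' i) j).2, ?_, rfl⟩)
    exact (mem_maximalIdeal_iff_valuation_lt_one O B hB hloc _).mp (hentry _ _)
  · -- the arrow tuples realise `(xg (i+1) / xg 0)^(e+1)`
    intro i
    let av : Fin (e + 2) → (Fin (e + 3) → ↥B) := fun a j =>
      if j = a.succ then xg i.succ else if j = i.succ then -(xg a.succ) else 0
    have hav_zero : ∀ a, av a 0 = 0 := by
      intro a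
      simp only [av, (Fin.succ_ne_zero a).symm, (Fin.succ_ne_zero i).symm, if_false]
    have hav_succ : ∀ a b : Fin (e + 2),
        av a b.succ = if b = a then xg i.succ else if b = i then -(xg a.succ) else 0 := by
      intro a b
      simp only [av, Fin.succ_inj]
    have hav : ∀ a, a ≠ i → av a ∈ LinearMap.ker φ := by
      intro a hai
      rw [hmemker, Fin.sum_univ_succ, hav_zero, zero_mul, zero_add]
      simp only [hav_succ]
      rw [Finset.sum_eq_add a i hai]
      · simp only [if_true, if_neg (Ne.symm hai)]
        ring
      · intro c _ hc
        rw [if_neg hc.1, if_neg hc.2, zero_mul]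
      · intro h; exact absurd (Finset.mem_univ a) h
      · intro h; exact absurd (Finset.mem_univ i) h
    let gA : Fin (e + 2) → ↥(LinearMap.range (d 1)) := fun a =>
      if h : a = i then g₀ i else θ ⟨av a, hav a h⟩
    have hgA : ∀ a b : Fin (e + 2), ι (gA a) b =
        if a = i then (if b = i then xg 0 else 0)
        else (if b = a then xg i.succ else if b = i then -(xg a.succ) else 0) := by
      intro a b
      by_cases h : a = i
      · subst h
        simp only [gA, dif_pos rfl, if_true, hg₀]
      · simp only [gA, dif_neg h, if_neg h]
        rw [hι_apply, hav_succ]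
    have hMA : (Matrix.of fun a b => ((ι (gA a) b : ↥B) : K)) =
        Matrix.of fun a b : Fin (e + 2) =>
          if a = i then (if b = i then ((xg 0 : ↥B) : K) else 0)
          else (if b = a then ((xg i.succ : ↥B) : K) else
            if b = i then -((xg a.succ : ↥B) : K) else 0) := by
      ext a b
      simp only [Matrix.of_apply, hgA]
      split_ifs <;> simp
    refine ⟨gA, ?_⟩
    rw [hdet₀, hMA, hCdet (e + 1) i _ _ (fun a => -((xg a.succ : ↥B) : K))]
    set X : K := ((xg 0 : ↥B) : K) with hX
    set Y : K := ((xg i.succ : ↥B) : K) with hY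
    calc X * Y ^ (e + 1) * (X ^ (e + 2))⁻¹ = X * Y ^ (e + 1) * (X⁻¹ * (X ^ (e + 1))⁻¹) := by
          rw [pow_succ' X (e + 1), mul_inv]
      _ = (X * X⁻¹) * (Y ^ (e + 1) * (X ^ (e + 1))⁻¹) := by ring
      _ = Y ^ (e + 1) * X⁻¹ ^ (e + 1) := by rw [mul_inv_cancel₀ hx0K, one_mul, inv_pow]
      _ = (Y * X⁻¹) ^ (e + 1) := by rw [mul_pow]



/-! ## The registered glue stub -/

/-- **STUB `stub_surfaceDatum` (crux stmt-ResolutionOfSingularities-17044, line `birth`)** — the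
datum of the surface step, `surfaceStep_datum` in registered `∀`-form. [folklore] -/
theorem stub_surfaceDatum : ∀ (k K : Type) [Field k] [Field K] [Algebra k K]
    (O : ValuationSubring K) (B : Subalgebra k K) [IsLocalRing ↥B],
      B.toSubring ≤ O.toSubring → locAt O B = B → ∀ (e : ℕ) (xg : Fin (e + 3) → ↥B),
      Ideal.span (Set.range xg) = IsLocalRing.maximalIdeal ↥B →
      (∀ s : Fin (e + 3) → ↥B, ∑ i, s i * xg i = 0 → ∀ i, s i ∈ IsLocalRing.maximalIdeal ↥B) →
      (∀ i, O.valuation ((xg i : ↥B) : K) ≤ O.valuation ((xg 0 : ↥B) : K)) →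
      ∀ (b : ℕ → ℕ) (d : (i : ℕ) → ((Fin (b (i + 1)) → ↥B) →ₗ[↥B] (Fin (b i) → ↥B)))
        (θ : ↥(LinearMap.ker (LinearMap.pi fun _ : Fin 1 => Fintype.linearCombination ↥B xg))
          ≃ₗ[↥B] ↥(LinearMap.range (d 1))),
      ∃ (r : ℕ) (ι : ↥(LinearMap.range (d 1)) →ₗ[↥B] (Fin r → ↥B))
        (g₀ : Fin r → ↥(LinearMap.range (d 1))),
        Function.Injective ι ∧
        (∀ z : Fin r → ↥B, ∃ a : ↥B, a ≠ 0 ∧ a • z ∈ LinearMap.range ι) ∧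
        Matrix.det (Matrix.of fun i j => ((ι (g₀ i) j : ↥B) : K)) ≠ 0 ∧
        (∀ g' : Fin r → ↥(LinearMap.range (d 1)),
          Matrix.det (Matrix.of fun i j => ((ι (g' i) j : ↥B) : K)) *
            (Matrix.det (Matrix.of fun i j => ((ι (g₀ i) j : ↥B) : K)))⁻¹ ∈ O) ∧
        (∀ g' : Fin r → ↥(LinearMap.range (d 1)),
          Matrix.det (Matrix.of fun i j => ((ι (g' i) j : ↥B) : K)) *
            (Matrix.det (Matrix.of fun i j => ((ι (g₀ i) j : ↥B) : K)))⁻¹ ∈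
            Algebra.adjoin k ((B : Set K) ∪
              {y : K | ∃ a ∈ B, O.valuation a < 1 ∧ y = a * (((xg 0 : ↥B) : K))⁻¹})) ∧
        (∀ i : Fin (e + 2), ∃ g' : Fin r → ↥(LinearMap.range (d 1)),
          Matrix.det (Matrix.of fun i j => ((ι (g' i) j : ↥B) : K)) *
            (Matrix.det (Matrix.of fun i j => ((ι (g₀ i) j : ↥B) : K)))⁻¹ =
              (((xg i.succ : ↥B) : K) * (((xg 0 : ↥B) : K))⁻¹) ^ (e + 1)) :=
  fun _ _ _ _ _ O B _ hB hloc _ xg hspan hminrel hval b d θ =>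
    surfaceStep_datum O B hB hloc xg hspan hminrel hval b d θ

end Summit.ResolutionOfSingularities.ResolutionOfSingularities.Theorems.SyzygyFlattening

end
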